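import Summits.QuantumFields.YangMills.Theses.IsotropyFromPowerCounting
import Summits.QuantumFields.YangMills.Theorems.SoftKernelBoostCovariance.Negative.TieLoadBearing
import Summits.QuantumFields.YangMills.Theorems.NPointIsotropy.Negative.NPointRegularJunk
import HarnessLib

/-!
# `CurvatureDensities` (Step 0): the model-blind core is FALSE; the lattice tie AT ORDER 4 is load-bearing

Support file for the item `IsotropyFromPowerCounting.CurvatureDensities` (stmt-QuantumFields-17723):
`W1 r sch S₁ → EightFrameRP S₁ → PlanarCone S₁ → NPointRegular S₁` (every `𝔖ₙ|⁰𝒮` of the curvature channel of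
a Wilson limit is integration against a function).  Tree objects only; nothing is posited.

Which hypotheses can carry a proof of the item?  The landed junk family `junk` of `NPointIsotropy.Negative`
(`𝔖₀ = 1`, `𝔖₄ = J`, `𝔖ₙ = 0` otherwise) satisfies every clause of the item that speaks about `S₁` alone — the OS
package E0–E4, translations and proper hypercubic invariance on `⁰𝒮`, a mass gap, reflection positivity in the eight
planar frames (landed `junk_hypotheses_withoutTieAt4`) and the planar spectral cone (landed `planarCone_junk`) — and it
is NOT `NPointRegular` (landed `not_nPointRegular_junk`: a representing `W₄` would vanish a.e.).  Over `G = SU(2)`,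
the fundamental representation and the zero scheme (`β ≡ 0`, `c ≡ 0`) it is moreover tied to Wilson's lattice theory
at every order `n ≠ 4` and carries the uniform lattice gap.  Hence:

* `not_curvatureDensities_modelBlind` — the MODEL-BLIND CORE of the item (drop `G`, `r`, `sch`, the tie and the
  lattice gap; keep every clause about `S₁`) is false;
* `not_curvatureDensities_withoutTieAt4` — the item with the Wilson-convergence clause required at every order
  `n ≠ 4` but NOT at `n = 4` (the lattice gap, the continuum gap, the eight frames and the cone all kept) is false;
* `curvatureDensities_of_modelBlind`, `curvatureDensities_of_withoutTieAt4` — both weakenings of the hypothesis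
  set imply the item, so: ANY PROOF of `CurvatureDensities` must use the convergence of the lattice FOUR-point
  functions of `tr F²` at order 4 itself (and, by the sibling file `…CurvatureDensitiesTameSector`, must use it in
  the wild sector `|c_k| → ∞`, `β_k ≠ 0`).

References: K. Osterwalder, R. Schrader, Comm. Math. Phys. 42 (1975) §4; J. Glimm, A. Jaffe, Quantum Physics
(1987) §6.1, §19.
-/

noncomputable section

namespace Summit.QuantumFields.YangMills.Theorems.CurvatureDensities

open scoped BigOperators SchwartzMap
open MeasureTheory Filter Topology
open Literature.MathematicalPhysics.QuantumLattice Literature.MathematicalPhysics.AQFT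
  Literature.MathematicalPhysics.QuantumFieldTheory
open Summit.QuantumFields.YangMills.Theorems.NPointIsotropy.Negative
  (E4 NPointRegular junk not_nPointRegular_junk junk_hypotheses_withoutTieAt4)
open Summit.QuantumFields.YangMills.Theorems.CurvatureBoostCovariance.Negative
  (OSPackage Translations Hypercubic EightFrameRP PlanarCone Tie Gaps W1)
open Summit.QuantumFields.YangMills.Theorems.SoftKernelBoostCovariance.Negative (planarCone_junk)

/-! ## The two weakenings of the hypothesis set, and the trivial implications -/

/-- **The model-blind core implies the item** (forget the gauge group, the representation, the scheme, the tie and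
the lattice gap). [folklore] -/
theorem curvatureDensities_of_modelBlind
    (h : ∀ S₁ : SchwingerFamily E4, OSPackage S₁ → Translations S₁ → Hypercubic S₁ →
      (∃ Δ : ℝ, 0 < Δ ∧ S₁.toLabelled.HasMassGap Δ) → EightFrameRP S₁ → PlanarCone S₁ → NPointRegular S₁) :
    Summit.QuantumFields.YangMills.Theses.IsotropyFromPowerCounting.CurvatureDensities := by
  intro G _ _ _ _ _ _ _ r sch S₁ hW h8 hC
  obtain ⟨-, hOS, htr, hhyp, Δ, hΔ, hgap, -⟩ := hW
  exact h S₁ hOS htr hhyp ⟨Δ, hΔ, hgap⟩ h8 hC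

/-- **The item without the tie at order 4 implies the item** (forget the tie at order 4). [folklore] -/
theorem curvatureDensities_of_withoutTieAt4
    (h : ∀ (G : Type) [Group G] [TopologicalSpace G] [IsTopologicalGroup G] [CompactSpace G]
      [MeasurableSpace G] [BorelSpace G], IsCompactSimpleLieGroup G →
      ∀ (r : LatticeRep G) (sch : SpeciesScheme (YMSpecies G)) (S₁ : SchwingerFamily E4),
        ((∀ (n : ℕ), n ≠ 0 → n ≠ 4 → ∀ (f : Fin n → 𝓢(E4, ℝ)) (F : 𝓢((Fin n → E4), ℂ)),
            IsTensorOf F (fun i => ofRealTest (f i)) → IsOffDiagonal F →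
              Tendsto (fun k : ℕ => ((latticeSchwinger r.ρ sch (fun s => s.F) k n
                (fun _ => r.curvature) f : ℝ) : ℂ)) atTop (𝓝 (S₁ n F))) ∧
          OSPackage S₁ ∧ Translations S₁ ∧ Hypercubic S₁ ∧ Gaps r sch S₁) →
        EightFrameRP S₁ → PlanarCone S₁ → NPointRegular S₁) :
    Summit.QuantumFields.YangMills.Theses.IsotropyFromPowerCounting.CurvatureDensities := by
  intro G _ _ _ _ _ _ hG r sch S₁ hW h8 hC
  exact h G hG r sch S₁ ⟨fun n hn _ f F hF hF' => hW.1 n hn f F hF hF', hW.2⟩ h8 hC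

/-! ## Both weakenings are false: junk -/

/-- **The model-blind core of `CurvatureDensities` is FALSE.**  The junk family satisfies the OS package,
translations, proper hypercubic invariance, a mass gap, reflection positivity in the eight planar frames and the
planar spectral cone, and is not `NPointRegular`.  So every proof of the item must use the lattice tie. -/
theorem not_curvatureDensities_modelBlind :
    ¬ ∀ S₁ : SchwingerFamily E4, OSPackage S₁ → Translations S₁ → Hypercubic S₁ →
      (∃ Δ : ℝ, 0 < Δ ∧ S₁.toLabelled.HasMassGap Δ) → EightFrameRP S₁ → PlanarCone S₁ → NPointRegular S₁ := by
  intro h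
  letI : MeasurableSpace (Matrix.specialUnitaryGroup (Fin 2) ℂ) := borel _
  haveI : BorelSpace (Matrix.specialUnitaryGroup (Fin 2) ℂ) := ⟨rfl⟩
  let r : LatticeRep (Matrix.specialUnitaryGroup (Fin 2) ℂ) :=
    ⟨2, fundamentalRep (Fin 2), continuous_fundamentalRep _, fundamentalRep_injective _,
      fundamentalRep_mem_unitaryGroup⟩
  obtain ⟨⟨-, hOS, htr, hhyp, Δ, hΔ, hgap, -⟩, h8, -⟩ := junk_hypotheses_withoutTieAt4 r
  exact not_nPointRegular_junk (h junk hOS htr hhyp ⟨Δ, hΔ, hgap⟩ h8 planarCone_junk)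

/-- **Theorem (the tie at order 4 is load-bearing for `CurvatureDensities`).**  The item with the Wilson-convergence
clause required at every order `n ≠ 4` but NOT at `n = 4` — the uniform lattice gap, the continuum gap, the eight
frames and the cone kept verbatim — is FALSE: `G = SU(2)`, the fundamental representation, the zero scheme
(`β ≡ 0`: `HasLatticeMassGap` for every rate; `c ≡ 0`: every lattice string vanishes, and `junk` vanishes in every
degree `∉ {0, 4}`, so it IS tied at every order `≠ 4`), `S₁ = junk`; and `junk` is not `NPointRegular`.  Hence any
proof of the item must use the convergence of the lattice FOUR-point functions of `tr F²` at order 4 itself. -/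
theorem not_curvatureDensities_withoutTieAt4 :
    ¬ ∀ (G : Type) [Group G] [TopologicalSpace G] [IsTopologicalGroup G] [CompactSpace G]
      [MeasurableSpace G] [BorelSpace G], IsCompactSimpleLieGroup G →
      ∀ (r : LatticeRep G) (sch : SpeciesScheme (YMSpecies G)) (S₁ : SchwingerFamily E4),
        ((∀ (n : ℕ), n ≠ 0 → n ≠ 4 → ∀ (f : Fin n → 𝓢(E4, ℝ)) (F : 𝓢((Fin n → E4), ℂ)),
            IsTensorOf F (fun i => ofRealTest (f i)) → IsOffDiagonal F →
              Tendsto (fun k : ℕ => ((latticeSchwinger r.ρ sch (fun s => s.F) k n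
                (fun _ => r.curvature) f : ℝ) : ℂ)) atTop (𝓝 (S₁ n F))) ∧
          OSPackage S₁ ∧ Translations S₁ ∧ Hypercubic S₁ ∧ Gaps r sch S₁) →
        EightFrameRP S₁ → PlanarCone S₁ → NPointRegular S₁ := by
  intro h
  have hG : IsCompactSimpleLieGroup (Matrix.specialUnitaryGroup (Fin 2) ℂ) :=
    isCompactSimpleLieGroup_specialUnitaryGroup isSimpleCompactGroup_specialUnitaryGroup_holds le_rfl
  letI : MeasurableSpace (Matrix.specialUnitaryGroup (Fin 2) ℂ) := borel _
  haveI : BorelSpace (Matrix.specialUnitaryGroup (Fin 2) ℂ) := ⟨rfl⟩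
  let r : LatticeRep (Matrix.specialUnitaryGroup (Fin 2) ℂ) :=
    ⟨2, fundamentalRep (Fin 2), continuous_fundamentalRep _, fundamentalRep_injective _,
      fundamentalRep_mem_unitaryGroup⟩
  obtain ⟨hW, h8, -⟩ := junk_hypotheses_withoutTieAt4 r
  exact not_nPointRegular_junk
    (h (Matrix.specialUnitaryGroup (Fin 2) ℂ) hG r (SpeciesScheme.zero _) junk hW h8 planarCone_junk)

end Summit.QuantumFields.YangMills.Theorems.CurvatureDensities

end
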